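import Mathlib
import Literature.MathematicalPhysics.QuantumLattice.GrassmannIntegralBerezinProofs
import Literature.MathematicalPhysics.QuantumLattice.GrassmannIntegralGaussianProofs
import Literature.MathematicalPhysics.QuantumLattice.GrassmannChargeScaling
import Literature.MathematicalPhysics.QuantumLattice.HubbardInteractionMoments
import HarnessLib

/-!
# Coefficientwise integration of Grassmann-algebra-valued weights (gauge-field integrals at
# fixed fermion sources) and the monomial eigenbasis of charge scalings

Topic `MathematicalPhysics/QuantumLattice`; infrastructure for the strong-coupling (`β = 0`)
gauge-field integration of Salmhofer–Seiler, *Proof of chiral symmetry breaking in strongly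
coupled lattice gauge theory*, Commun. Math. Phys. **139** (1991) 395–432, §2 (2.9)–(2.12) and
(2.16)–(2.20): there the partition function `Z_Λ = ∫ 𝒟ψψ̄ 𝒟U e^{-S}` mixes the Berezin integral
over the Grassmann generators `ψ̄_a(x), ψ_a(x)` with the product Haar measure `𝒟U = ∏ dU_μ(x)` on
`U(N)`, and "at `β = 0` the gauge integration can be done separately on each link" (p. 400): one
integrates a Grassmann-algebra-valued function of the link variable against Haar measure.  This
file makes that operation precise on the tree's Grassmann algebra
`GrassmannAlgebra R ι = ExteriorAlgebra R (ι → R)` (`GrassmannIntegral.lean`) over `R = ℂ`,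
WITHOUT topologising the exterior algebra: every element is its finite list of coordinates in the
monomial basis `grassmannBasis` (Berezin 1966, Ch. I §3, (3.3)), and a function `F : Ω → Λ(θ)` is
integrated coordinate by coordinate (`GrassmannAlgebra.cintegral`; this IS the Bochner integral in
the finite-dimensional space `Λ(θ) ≅ ℂ^{2^{|ι|}}`, written in coordinates).

## Contents (all proved; no named facts)

* `GrassmannAlgebra.coord s a` — the coordinate of `a` on `θ_s`; expansion `eq_sum_coord_smul`, the
  coordinate calculus `coord_add/smul/sum/basis/mul`, `ext_coord`; the truncated exponential with
  complex coefficients `grassmannExp_eq_sum`.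
* `CoeffContinuous F` (all coordinates continuous) — closed under `+`, scalar multiples, finite sums,
  products, powers and `grassmannExp` with a uniform nilpotency bound (`CoeffContinuous.exp`);
  `CoeffIntegrable`; on a compact space with a finite measure continuity gives integrability.
* `cintegral μ F` — the coefficientwise integral; `coord_cintegral`, `cintegral_sum_smul`, linear maps
  and functionals commute with it (`map_cintegral`, `apply_cintegral` — in particular the Berezin
  integral), constant factors come out (`cintegral_const_mul_mul_const`), constants
  (`cintegral_const`), invariance under left/right translation for an invariant measure on a group
  (`cintegral_comp_mul_left/right` — the form in which the bi-invariance of Haar measure on `U(N)`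
  is used), and **independence of the link integrals** under a product measure
  (`cintegral_pi_prod_ofFn`: an ordered product of factors depending on distinct coordinates
  integrates to the ordered product of the integrals — Salmhofer–Seiler p. 400, "separately on
  each link").
* `map_mulLeft_grassmannBasis`, `coord_map_mulLeft`, `coord_eq_zero_of_map_mulLeft_eq` — the
  monomial basis is an eigenbasis of every rescaling `θ_i ↦ c_i θ_i` of the generators
  (`GrassmannChargeScaling.lean`), eigenvalue `∏_{i∈s} c_i`; hence a coordinate of an invariant
  element vanishes unless its eigenvalue is `1` (the selection-rule mechanism used for the one-link
  integral in `RossiWolffOneLinkIntegral.lean`).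

## Sources

M. Salmhofer, E. Seiler, Commun. Math. Phys. 139 (1991) 395–432, §2, (2.9)–(2.12) (the mixed
Berezin–Haar integrals), p. 400 (link-by-link integration at `β = 0`) [`SalmhoferSeiler1991`];
F. A. Berezin, *The Method of Second Quantization* (1966), Ch. I §3 ((3.3): monomial expansion;
automorphisms induced by linear maps of the generators) [`Berezin1966`].  The statements of this
file are routine consequences of these definitions.

## Design

Coefficients are taken in `ℂ` (the case needed for `U(N)` link variables); `Ω` is any measurable
space and `μ` any measure (a probability measure where constants are integrated).  The ordered
products in `cintegral_pi_prod_ofFn` are `List.ofFn`-products along an injective enumeration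
`e : Fin n ↪ E` of (some of) the coordinates of `E → Ω`, so no commutativity is assumed.
-/

noncomputable section

open MeasureTheory Finset
open Literature.MathematicalPhysics.QuantumLattice
open Literature.MathematicalPhysics.QuantumLattice.GrassmannAlgebra

namespace Literature.MathematicalPhysics.QuantumLattice

namespace GrassmannAlgebra

variable {κ : Type*} [LinearOrder κ] [Fintype κ]

/-! ### Coordinates -/

/-- The coordinate `a_s` of `a` on the monomial `θ_s` of the monomial basis (Berezin 1966, (3.3):
`a = ∑_s a_s θ_s`). [cite: Berezin1966, Ch. I §3 (3.3)] -/
def coord (s : Finset κ) (a : GrassmannAlgebra ℂ κ) : ℂ := (grassmannBasis ℂ κ).repr a s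

omit [LinearOrder κ] [Fintype κ] in
/-- A rational scalar acts through its image in `ℂ`. [cite: Berezin1966, Ch. I §3] -/
theorem ratCast_smul_eq (q : ℚ) (a : GrassmannAlgebra ℂ κ) : (q : ℂ) • a = q • a :=
  algebraMap_smul ℂ q a

omit [LinearOrder κ] [Fintype κ] in
/-- The truncated exponential with complex coefficients: `exp a = ∑_{i<k} aⁱ/i!` whenever `aᵏ = 0`
(Berezin 1966, Ch. I §3; Mathlib's `IsNilpotent.exp`). [cite: Berezin1966, Ch. I §3] -/
theorem grassmannExp_eq_sum {a : GrassmannAlgebra ℂ κ} {k : ℕ} (hk : a ^ k = 0) :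
    grassmannExp a = ∑ i ∈ Finset.range k, ((i.factorial : ℂ)⁻¹) • a ^ i := by
  rw [grassmannExp, IsNilpotent.exp_eq_sum hk]
  refine Finset.sum_congr rfl fun i _ => ?_
  rw [← ratCast_smul_eq, Rat.cast_inv, Rat.cast_natCast]

/-- **Monomial expansion** `a = ∑_s a_s θ_s` (Berezin 1966, (3.3)). [cite: Berezin1966, Ch. I §3 (3.3)] -/
theorem eq_sum_coord_smul (a : GrassmannAlgebra ℂ κ) :
    a = ∑ s : Finset κ, coord s a • grassmannBasis ℂ κ s := by
  conv_lhs => rw [← (grassmannBasis ℂ κ).sum_repr a]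
  rfl

/-- Coordinates are additive. [cite: Berezin1966, Ch. I §3 (3.3)] -/
theorem coord_add (s : Finset κ) (a b : GrassmannAlgebra ℂ κ) :
    coord s (a + b) = coord s a + coord s b := by simp [coord]

/-- Coordinates are homogeneous. [cite: Berezin1966, Ch. I §3 (3.3)] -/
theorem coord_smul (s : Finset κ) (c : ℂ) (a : GrassmannAlgebra ℂ κ) :
    coord s (c • a) = c * coord s a := by simp [coord]

/-- Coordinates of a finite sum. [cite: Berezin1966, Ch. I §3 (3.3)] -/
theorem coord_sum {α : Type*} (S : Finset α) (s : Finset κ) (a : α → GrassmannAlgebra ℂ κ) :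
    coord s (∑ i ∈ S, a i) = ∑ i ∈ S, coord s (a i) := by
  simp [coord, map_sum, Finsupp.coe_finsetSum, Finset.sum_apply]

/-- Coordinates of a basis monomial. [cite: Berezin1966, Ch. I §3 (3.3)] -/
theorem coord_basis (s t : Finset κ) :
    coord s (grassmannBasis ℂ κ t) = if t = s then 1 else 0 := by
  simp [coord, Finsupp.single_apply]

/-- Coordinates of a product are bilinear in the coordinates of the factors (structure constants
`(θ_s θ_{s'})_t`). [cite: Berezin1966, Ch. I §3 (3.3)] -/
theorem coord_mul (a b : GrassmannAlgebra ℂ κ) (t : Finset κ) :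
    coord t (a * b) = ∑ s : Finset κ, ∑ s' : Finset κ,
      coord s a * coord s' b * coord t (grassmannBasis ℂ κ s * grassmannBasis ℂ κ s') := by
  conv_lhs => rw [eq_sum_coord_smul a, eq_sum_coord_smul b, Finset.sum_mul]
  simp only [Finset.mul_sum, smul_mul_smul_comm, coord_sum, coord_smul, mul_assoc]

/-- Two elements with the same coordinates are equal (uniqueness of the monomial expansion,
Berezin 1966, (3.3)). [cite: Berezin1966, Ch. I §3 (3.3)] -/
theorem ext_coord {a b : GrassmannAlgebra ℂ κ} (h : ∀ s, coord s a = coord s b) : a = b :=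
  (grassmannBasis ℂ κ).repr.injective (Finsupp.ext h)

/-! ### Coefficientwise continuity -/

section Continuity

variable {Ω : Type*} [TopologicalSpace Ω]

/-- All coordinates of `F ω` depend continuously on `ω` (the regularity of the link weights
`U ↦ e^{-S_F(U)}` of Salmhofer–Seiler (2.9)–(2.12), which are polynomial in the entries of `U`).
[cite: SalmhoferSeiler1991, §2 (2.9)–(2.12)] -/
def CoeffContinuous (F : Ω → GrassmannAlgebra ℂ κ) : Prop :=
  ∀ s : Finset κ, Continuous fun ω => coord s (F ω)

/-- Constants are coefficientwise continuous. [cite: SalmhoferSeiler1991, §2 (2.9)–(2.12)] -/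
theorem CoeffContinuous.const (a : GrassmannAlgebra ℂ κ) : CoeffContinuous fun _ : Ω => a :=
  fun _ => continuous_const

/-- Sums of coefficientwise continuous families. [cite: SalmhoferSeiler1991, §2 (2.9)–(2.12)] -/
theorem CoeffContinuous.add {F G : Ω → GrassmannAlgebra ℂ κ} (hF : CoeffContinuous F)
    (hG : CoeffContinuous G) : CoeffContinuous fun ω => F ω + G ω := fun s => by
  simp only [coord_add]; exact (hF s).add (hG s)

/-- Continuous scalar multiples of coefficientwise continuous families. [cite: SalmhoferSeiler1991, §2 (2.9)–(2.12)] -/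
theorem CoeffContinuous.smul {F : Ω → GrassmannAlgebra ℂ κ} (hF : CoeffContinuous F) {c : Ω → ℂ}
    (hc : Continuous c) : CoeffContinuous fun ω => c ω • F ω := fun s => by
  simp only [coord_smul]; exact hc.mul (hF s)

/-- Finite sums of coefficientwise continuous families. [cite: SalmhoferSeiler1991, §2 (2.9)–(2.12)] -/
theorem CoeffContinuous.sum {α : Type*} (S : Finset α) {F : α → Ω → GrassmannAlgebra ℂ κ}
    (hF : ∀ i ∈ S, CoeffContinuous (F i)) : CoeffContinuous fun ω => ∑ i ∈ S, F i ω := fun s => by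
  simp only [coord_sum]; exact continuous_finsetSum S fun i hi => hF i hi s

/-- Products of coefficientwise continuous families (via `coord_mul`). [cite: SalmhoferSeiler1991, §2 (2.9)–(2.12)] -/
theorem CoeffContinuous.mul {F G : Ω → GrassmannAlgebra ℂ κ} (hF : CoeffContinuous F)
    (hG : CoeffContinuous G) : CoeffContinuous fun ω => F ω * G ω := fun t => by
  rw [show (fun ω => coord t (F ω * G ω)) = _ from funext fun ω => coord_mul (F ω) (G ω) t]
  exact continuous_finsetSum _ fun s _ => continuous_finsetSum _ fun s' _ =>
    ((hF s).mul (hG s')).mul continuous_const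

/-- Powers of coefficientwise continuous families. [cite: SalmhoferSeiler1991, §2 (2.9)–(2.12)] -/
theorem CoeffContinuous.pow {F : Ω → GrassmannAlgebra ℂ κ} (hF : CoeffContinuous F) (n : ℕ) :
    CoeffContinuous fun ω => F ω ^ n := by
  induction n with
  | zero => simpa using CoeffContinuous.const (Ω := Ω) (1 : GrassmannAlgebra ℂ κ)
  | succ n ih => simpa [pow_succ] using ih.mul hF

/-- The truncated exponential of a coefficientwise continuous family with a uniform nilpotency
bound is coefficientwise continuous. [cite: SalmhoferSeiler1991, §2 (2.9)–(2.12)] -/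
theorem CoeffContinuous.exp {F : Ω → GrassmannAlgebra ℂ κ} (hF : CoeffContinuous F)
    {k : ℕ} (hk : ∀ ω, F ω ^ k = 0) :
    CoeffContinuous fun ω => QuantumLattice.grassmannExp (F ω) := by
  have : (fun ω => QuantumLattice.grassmannExp (F ω)) =
      fun ω => ∑ i ∈ Finset.range k, ((i.factorial : ℂ)⁻¹) • F ω ^ i := by
    funext ω; exact grassmannExp_eq_sum (hk ω)
  rw [this]
  exact CoeffContinuous.sum _ fun i _ => (hF.pow i).smul continuous_const

end Continuity

/-! ### The coefficientwise integral -/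

section Integral

variable {Ω : Type*} [MeasurableSpace Ω] (μ : Measure Ω)

/-- **The coefficientwise integral** `∫ F dμ := ∑_s (∫ F(ω)_s dμ(ω)) θ_s` of a
Grassmann-algebra-valued function, taken coordinate by coordinate in the monomial basis — the
Bochner integral in the finite-dimensional space `Λ(θ)`, written without topologising the exterior
algebra.  This is the operation `∫ 𝒟U (⋯)` of Salmhofer–Seiler (2.9)–(2.12) at fixed Grassmann
sources, e.g. the one-link integral `∫ dU exp(ψ̄(x)Uψ(y) + ⋯)` of (2.16). [cite: SalmhoferSeiler1991, §2 (2.9)–(2.12)] -/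
def cintegral (F : Ω → GrassmannAlgebra ℂ κ) : GrassmannAlgebra ℂ κ :=
  ∑ s : Finset κ, (∫ ω, coord s (F ω) ∂μ) • grassmannBasis ℂ κ s

/-- All coordinates of `F` are integrable. [cite: SalmhoferSeiler1991, §2 (2.9)–(2.12)] -/
def CoeffIntegrable (F : Ω → GrassmannAlgebra ℂ κ) : Prop :=
  ∀ s : Finset κ, Integrable (fun ω => coord s (F ω)) μ

variable {μ}

/-- The coordinates of the coefficientwise integral are the integrals of the coordinates. [cite: SalmhoferSeiler1991, §2 (2.9)–(2.12)] -/
theorem coord_cintegral (F : Ω → GrassmannAlgebra ℂ κ) (s : Finset κ) :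
    coord s (cintegral μ F) = ∫ ω, coord s (F ω) ∂μ := by
  simp [cintegral, coord_sum, coord_smul, coord_basis]

/-- Integrating a finite combination `∑_g c_g(ω) • A_g` with constant `A_g`: `∑_g (∫ c_g) • A_g`. [cite: SalmhoferSeiler1991, §2 (2.9)–(2.12)] -/
theorem cintegral_sum_smul {α : Type*} (G : Finset α) (c : α → Ω → ℂ) (A : α → GrassmannAlgebra ℂ κ)
    (hc : ∀ g ∈ G, Integrable (c g) μ) :
    cintegral μ (fun ω => ∑ g ∈ G, c g ω • A g) = ∑ g ∈ G, (∫ ω, c g ω ∂μ) • A g := by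
  refine ext_coord fun s => ?_
  rw [coord_cintegral]
  simp only [coord_sum, coord_smul]
  rw [integral_finsetSum _ fun g hg => (hc g hg).mul_const _]
  refine Finset.sum_congr rfl fun g _ => ?_
  rw [integral_mul_const]

/-- On a compact space, against a measure finite on compacts, coefficientwise continuity gives
coefficientwise integrability (the case of the link variables `U ∈ U(N)`). [cite: SalmhoferSeiler1991, §2 (2.12)] -/
theorem CoeffContinuous.coeffIntegrable [TopologicalSpace Ω] [OpensMeasurableSpace Ω]
    [CompactSpace Ω] [IsFiniteMeasureOnCompacts μ] {F : Ω → GrassmannAlgebra ℂ κ}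
    (hF : CoeffContinuous F) : CoeffIntegrable μ F :=
  fun s => (hF s).integrable_of_hasCompactSupport (HasCompactSupport.of_compactSpace _)

/-- A linear map commutes with the coefficientwise integral (used for the automorphisms of the
Grassmann algebra induced by symmetries of the Haar measure). [cite: SalmhoferSeiler1991, §2 (2.9)–(2.12)] -/
theorem map_cintegral {κ' : Type*} [LinearOrder κ'] [Fintype κ']
    (φ : GrassmannAlgebra ℂ κ →ₗ[ℂ] GrassmannAlgebra ℂ κ') {F : Ω → GrassmannAlgebra ℂ κ}
    (hF : CoeffIntegrable μ F) : φ (cintegral μ F) = cintegral μ (fun ω => φ (F ω)) := by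
  have h : (fun ω => φ (F ω)) = fun ω => ∑ s : Finset κ, coord s (F ω) • φ (grassmannBasis ℂ κ s) := by
    funext ω
    conv_lhs => rw [eq_sum_coord_smul (F ω)]
    simp only [map_sum, map_smul]
  rw [h, cintegral_sum_smul _ _ _ fun s _ => hF s, cintegral]
  simp only [map_sum, map_smul]

/-- A linear functional commutes with the coefficientwise integral — in particular the Berezin
integral: `∫dU ∫dψ̄dψ F(U, ψ̄, ψ) = ∫dψ̄dψ ∫dU F` (the order of integrations in Salmhofer–Seiler
(2.9)). [cite: SalmhoferSeiler1991, §2 (2.9)] -/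
theorem apply_cintegral (φ : GrassmannAlgebra ℂ κ →ₗ[ℂ] ℂ) {F : Ω → GrassmannAlgebra ℂ κ}
    (hF : CoeffIntegrable μ F) : φ (cintegral μ F) = ∫ ω, φ (F ω) ∂μ := by
  have h : (fun ω => φ (F ω)) = fun ω => ∑ s : Finset κ, coord s (F ω) * φ (grassmannBasis ℂ κ s) := by
    funext ω
    conv_lhs => rw [eq_sum_coord_smul (F ω)]
    simp only [map_sum, map_smul, smul_eq_mul]
  rw [h, integral_finsetSum _ fun s _ => (hF s).mul_const _, cintegral]
  simp only [map_sum, map_smul, smul_eq_mul, integral_mul_const]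

/-- Constant left and right factors come out of the coefficientwise integral. [cite: SalmhoferSeiler1991, §2 (2.9)–(2.12)] -/
theorem cintegral_const_mul_mul_const (A B : GrassmannAlgebra ℂ κ) {F : Ω → GrassmannAlgebra ℂ κ}
    (hF : CoeffIntegrable μ F) :
    cintegral μ (fun ω => A * F ω * B) = A * cintegral μ F * B := by
  have := map_cintegral ((LinearMap.mulLeft ℂ A).comp (LinearMap.mulRight ℂ B)) hF
  simpa [mul_assoc] using this.symm

/-- A constant left factor comes out of the coefficientwise integral. [cite: SalmhoferSeiler1991, §2 (2.9)–(2.12)] -/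
theorem cintegral_const_mul (A : GrassmannAlgebra ℂ κ) {F : Ω → GrassmannAlgebra ℂ κ}
    (hF : CoeffIntegrable μ F) : cintegral μ (fun ω => A * F ω) = A * cintegral μ F := by
  simpa using cintegral_const_mul_mul_const A 1 hF

/-- Pointwise equal integrands have the same coefficientwise integral. [cite: SalmhoferSeiler1991, §2 (2.9)–(2.12)] -/
theorem cintegral_congr {F G : Ω → GrassmannAlgebra ℂ κ} (h : ∀ ω, F ω = G ω) :
    cintegral μ F = cintegral μ G := by
  simp only [cintegral, h]

/-- The coefficientwise integral of a constant against a probability measure. [cite: SalmhoferSeiler1991, §2 (2.12)] -/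
theorem cintegral_const [IsProbabilityMeasure μ] (A : GrassmannAlgebra ℂ κ) :
    cintegral μ (fun _ => A) = A := by
  refine ext_coord fun s => ?_
  rw [coord_cintegral, integral_const]
  simp

end Integral

/-! ### Invariance under the group -/

section Group

variable {G : Type*} [Group G] [MeasurableSpace G] [MeasurableMul G] (μ : Measure G)

/-- **Left invariance**: for a left-invariant measure on a group, `∫ F(g h) dh = ∫ F(h) dh`
(used with Haar measure on `U(N)`, Salmhofer–Seiler (2.12)). [cite: SalmhoferSeiler1991, §2 (2.12)] -/
theorem cintegral_comp_mul_left [μ.IsMulLeftInvariant] (F : G → GrassmannAlgebra ℂ κ) (g : G) :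
    cintegral μ (fun h => F (g * h)) = cintegral μ F := by
  refine ext_coord fun s => ?_
  rw [coord_cintegral, coord_cintegral]
  exact integral_mul_left_eq_self (fun h => coord s (F h)) g

/-- **Right invariance**: for a right-invariant measure on a group, `∫ F(h g) dh = ∫ F(h) dh`. [cite: SalmhoferSeiler1991, §2 (2.12)] -/
theorem cintegral_comp_mul_right [μ.IsMulRightInvariant] (F : G → GrassmannAlgebra ℂ κ) (g : G) :
    cintegral μ (fun h => F (h * g)) = cintegral μ F := by
  refine ext_coord fun s => ?_
  rw [coord_cintegral, coord_cintegral]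
  exact integral_mul_right_eq_self (fun h => coord s (F h)) g

end Group

end GrassmannAlgebra
end Literature.MathematicalPhysics.QuantumLattice

namespace Literature.MathematicalPhysics.QuantumLattice

namespace GrassmannAlgebra

open MeasureTheory Finset

variable {κ : Type*} [LinearOrder κ] [Fintype κ]

/-! ### Products over independent coordinates -/

variable {Ω : Type*} [MeasurableSpace Ω]

/-- **Independence of the link integrals**: under the product measure `∏_e dμ(U_e)`, an ordered
product of factors each depending on its own coordinate integrates to the ordered product of the
integrals — "at `β = 0` the gauge integration can be done separately on each link"
(Salmhofer–Seiler p. 400; (2.12) `𝒟U = ∏ dU_μ(x)`). [cite: SalmhoferSeiler1991, §2 (2.12) and p. 400] -/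
theorem cintegral_pi_prod_ofFn {E : Type*} [Fintype E] [DecidableEq E] {n : ℕ} (e : Fin n ↪ E)
    (μ : Measure Ω) [IsProbabilityMeasure μ] (F : E → Ω → GrassmannAlgebra ℂ κ) (hF : ∀ x, CoeffIntegrable μ (F x)) :
    cintegral (Measure.pi fun _ : E => μ) (fun ω => (List.ofFn fun i => F (e i) (ω (e i))).prod) =
      (List.ofFn fun i => cintegral μ (F (e i))).prod := by
  classical
  -- expand every factor in the monomial basis
  have hexp : ∀ ω : E → Ω, (List.ofFn fun i => F (e i) (ω (e i))).prod =
      ∑ g : Fin n → Finset κ, (∏ i, coord (g i) (F (e i) (ω (e i)))) •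
        (List.ofFn fun i => grassmannBasis ℂ κ (g i)).prod := by
    intro ω
    have h := prod_ofFn_sum_smul (fun i s => coord s (F (e i) (ω (e i)))) (fun _ s => grassmannBasis ℂ κ s)
    rw [← h]
    exact congrArg List.prod (congrArg List.ofFn (funext fun i => eq_sum_coord_smul _))
  -- the coefficient of each `g` is a product over distinct coordinates: extend it to all of `E`
  have hext : ∀ (g : Fin n → Finset κ) (ω : E → Ω),
      (∏ i, coord (g i) (F (e i) (ω (e i)))) =
        ∏ x : E, (if h : ∃ i, e i = x then coord (g h.choose) (F x (ω x)) else 1) := by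
    intro g ω
    rw [← Finset.prod_subset (Finset.subset_univ (Finset.univ.map e)), Finset.prod_map]
    · refine Finset.prod_congr rfl fun i _ => ?_
      have h : ∃ j, e j = e i := ⟨i, rfl⟩
      rw [dif_pos h, e.injective h.choose_spec]
    · intro x _ hx
      rw [dif_neg]
      rintro ⟨i, rfl⟩
      exact hx (Finset.mem_map_of_mem _ (Finset.mem_univ i))
  have hexp' : ∀ ω : E → Ω, (List.ofFn fun i => F (e i) (ω (e i))).prod =
      ∑ g : Fin n → Finset κ, (∏ x : E, (if h : ∃ i, e i = x then coord (g h.choose) (F x (ω x)) else 1)) •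
        (List.ofFn fun i => grassmannBasis ℂ κ (g i)).prod := fun ω => by
    rw [hexp ω]; exact Finset.sum_congr rfl fun g _ => by rw [hext g ω]
  rw [cintegral_congr hexp', cintegral_sum_smul]
  · have hint : ∀ g : Fin n → Finset κ,
        (∫ ω : E → Ω, ∏ x : E, (if h : ∃ i, e i = x then coord (g h.choose) (F x (ω x)) else 1)
          ∂Measure.pi fun _ => μ) = ∏ i, ∫ ω, coord (g i) (F (e i) ω) ∂μ := by
      intro g
      rw [integral_fintype_prod_eq_prod
        (f := fun x v => if h : ∃ i, e i = x then coord (g h.choose) (F x v) else 1),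
        ← Finset.prod_subset (Finset.subset_univ (Finset.univ.map e)), Finset.prod_map]
      · refine Finset.prod_congr rfl fun i _ => ?_
        have h : ∃ j, e j = e i := ⟨i, rfl⟩
        simp_rw [dif_pos h]
        rw [e.injective h.choose_spec]
      · intro x _ hx
        have h : ¬∃ i, e i = x := by
          rintro ⟨i, rfl⟩; exact hx (Finset.mem_map_of_mem _ (Finset.mem_univ i))
        simp_rw [dif_neg h]
        rw [integral_const]
        simp
    rw [Finset.sum_congr rfl fun g _ => by rw [hint g]]
    have h := prod_ofFn_sum_smul (fun i s => ∫ ω, coord s (F (e i) ω) ∂μ) (fun _ s => grassmannBasis ℂ κ s)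
    simp only [cintegral]
    exact h.symm
  · intro g _
    refine Integrable.fintype_prod (f := fun x ω => if h : ∃ i, e i = x then coord (g h.choose) (F x ω) else 1) ?_
    intro x
    by_cases h : ∃ i, e i = x
    · simp_rw [dif_pos h]; exact hF x _
    · simp_rw [dif_neg h]; exact integrable_const _

end GrassmannAlgebra

end Literature.MathematicalPhysics.QuantumLattice

namespace Literature.MathematicalPhysics.QuantumLattice

open GrassmannAlgebra

namespace GrassmannAlgebra

variable {κ : Type*} [LinearOrder κ] [Fintype κ]

/-! ### The monomial basis is an eigenbasis of every scaling -/

omit [Fintype κ] in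
/-- Pulling scalars out of an ordered product of rescaled generators. [cite: Berezin1966, Ch. I §3] -/
theorem list_prod_map_smul_gen (c : κ → ℂ) (l : List κ) :
    (l.map fun i => c i • gen ℂ i).prod = (l.map c).prod • (l.map (gen ℂ)).prod := by
  induction l with
  | nil => simp
  | cons a l ih => rw [List.map_cons, List.prod_cons, ih, List.map_cons, List.prod_cons, List.map_cons,
      List.prod_cons, smul_mul_smul_comm]

/-- **The monomial basis is an eigenbasis of every rescaling of the generators**:
`S_c θ_s = (∏_{i ∈ s} c_i) θ_s` for `S_c : θ_i ↦ c_i θ_i` (Berezin 1966, Ch. I §3: automorphisms induced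
by linear maps of the generators). [cite: Berezin1966, Ch. I §3] -/
theorem map_mulLeft_grassmannBasis (c : κ → ℂ) (s : Finset κ) :
    ExteriorAlgebra.map (LinearMap.mulLeft ℂ c) (grassmannBasis ℂ κ s) = (∏ i ∈ s, c i) • grassmannBasis ℂ κ s := by
  rw [grassmannBasis_eq_prod_map_gen, map_list_prod, List.map_map]
  have h : (ExteriorAlgebra.map (LinearMap.mulLeft ℂ c)) ∘ gen ℂ = fun i => c i • gen ℂ i :=
    funext fun i => map_mulLeft_gen ℂ c i
  rw [h, list_prod_map_smul_gen]
  congr 1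
  rw [← List.prod_toFinset _ (Finset.sort_nodup _ _), Finset.sort_toFinset]

/-- Coordinates of a rescaled element: `(S_c a)_s = (∏_{i∈s} c_i) a_s`. [cite: Berezin1966, Ch. I §3] -/
theorem coord_map_mulLeft (c : κ → ℂ) (a : GrassmannAlgebra ℂ κ) (s : Finset κ) :
    coord s (ExteriorAlgebra.map (LinearMap.mulLeft ℂ c) a) = (∏ i ∈ s, c i) * coord s a := by
  conv_lhs => rw [eq_sum_coord_smul a]
  simp only [map_sum, map_smul, map_mulLeft_grassmannBasis, coord_sum, coord_smul, coord_basis, mul_ite,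
    mul_one, mul_zero, Finset.sum_ite_eq', Finset.mem_univ, if_true]
  ring

/-- **Selection rule**: a coordinate of an `S_c`-invariant element vanishes unless its eigenvalue
`∏_{i∈s} c_i` is `1`. [cite: Berezin1966, Ch. I §3] -/
theorem coord_eq_zero_of_map_mulLeft_eq {c : κ → ℂ} {a : GrassmannAlgebra ℂ κ}
    (h : ExteriorAlgebra.map (LinearMap.mulLeft ℂ c) a = a) {s : Finset κ} (hs : ∏ i ∈ s, c i ≠ 1) :
    coord s a = 0 := by
  have := coord_map_mulLeft c a s
  rw [h] at this
  have h2 : (∏ i ∈ s, c i - 1) * coord s a = 0 := by rw [sub_mul, one_mul, ← this, sub_self]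
  exact (mul_eq_zero.1 h2).resolve_left (sub_ne_zero.2 hs)

end GrassmannAlgebra

end Literature.MathematicalPhysics.QuantumLattice
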